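import Literature.MathematicalPhysics.QuantumFieldTheory.Balaban1983to89.B1TorusCubeBoxOp
import Literature.MathematicalPhysics.QuantumFieldTheory.Balaban1983to89.B4Lemma22ReduceDeriv
import Literature.MathematicalPhysics.QuantumFieldTheory.Balaban1983to89.B2Restr216Lattice

/-!
# `Balaban1983to89.B1TorusCubeDeriv` — THE COVARIANT DERIVATIVE `D^ε_A` OF [Balaban1982Higgs1] (1.7) ALONG THE CUBE CHART OF
# [Balaban1983RegularityDecay] §2 ON THE (Higgs)₂,₃ TORUS: Leibniz rule for `h_jψ`, the bond dictionary `D^ε_{Ã_j} ↔ (L^Kε)⁻¹·D^η_{Ã}`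
# (the lineage's `derivA` on the box), «|∂^ηh_j| ≤ O(M⁻¹)» for the torus bumps, and the per-cube input of the DERIVATIVE member of
# Theorem (1.10) for the torus walk: `‖D^ε_A(h_jG_j(h_jψ))‖_∞ ≤ γ_D + O(M⁻¹)(L^Kε)⁻¹γ`

statement-level skeleton of published theorems with citation tags; proofs where landed; nothing here is a claim about the Yang–Mills mass gap

CITATION HEADER (lean-in-tree rule).  T. Bałaban, *Regularity and decay of lattice Green's functions*, Commun. Math. Phys. **89** (1983)
571–597 [Balaban1983RegularityDecay] ((1.3) p. 572 `D^η_{A,μ}`, §2 pp. 575–577 cubes/`h_j`/`Ã_j`, «|∂^ηh_j| ≤ O(M⁻¹)» p. 577, Lemma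
2.2 (2.17) p. 578, Theorem (1.10) p. 573) and T. Bałaban, *(Higgs)₂,₃ quantum fields in a finite volume. I*, Commun. Math. Phys. **85**
(1982) 603–626 [Balaban1982Higgs1] ((1.4) p. 604 `∂^ε`, (1.7) p. 605 `D^ε_A`, Prop. 2.1 (2.25) p. 610 the derivative clause).  Cell
`lit-balaban` (HOME `run/shared/lean/pub/lit-balaban/`), Phase-2 proof seat **p35** gen 9 (unit `lit-balaban-p35`); SKELETON rows
**B4.Thm@573** ((1.10) derivative member on the torus), **B1.Prop2.1** ((2.25) derivative clause at `A ≠ 0`), **B4.Lem2.2** ((2.17)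
derivative member read on the torus cubes).  USED BY NAME, never restated: the typer's `HiggsLattice.{covDeriv, sderiv, ChargeData.U}`,
r02's `B2Restr216Lattice.norm_U_apply`; gen 8's `B1TorusCubeCover`, `B1TorusCubeLocality26`, `B1TorusCubeChart` (`toT`, `fromT`, `pull`, `toT_add_e1`,
`add_e1_mem_box_iff`, `mem_cube_iff`), `B1TorusCubeBoxOp.{flowC, boxField, boxField_fwd, ofLp_U, hTor_toT, fld_pull_ofLp}`; the lineage's
`B4Lemma22ReduceZero.derivA`, `B4Lemma21Region.fld_covDeriv_mulVec_of_mem`, `B4Eq220PartitionSizes.hsize_hBox` (`HSize.grad_le`),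
`B4Lemma22ReduceDeriv.add_e1_mem_nbrs`.

WHAT IS PRINTED (v1.1: the (1.3) quotation corrected per referee ref-1 gen 52 F4 — v1 put the site/direction READING of (1.3) inside
guillemets; no declaration changed).  [B4] p. 572 [PDF 2], verbatim from the ×2 render: *«Now the covariant Laplace operator −Δ^{η,N}_{A,Ω} on
a domain Ω with Neumann boundary conditions on ∂Ω is given by the following quadratic form defined on functions φ : Ω → R^N
⟨φ, (−Δ^{η,N}_{A,Ω})φ⟩ = Σ_{b⊂Ω} η^d|(D^η_Aφ)(b)|² = Σ_{b⊂Ω} η^d|η^{−1}(U(A_b)φ(b₊) − φ(b₋))|², (1.3) where the summation is over the set of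
all bonds b = ⟨b₋, b₊⟩ with end-points b₋, b₊ in Ω.»* and *«We identify them with vector-valued functions defined on points of the lattice
by the identity A_{⟨x,x+ηe_μ⟩} = A_μ(x), where e_μ is a unit vector of μth axis.»*; READING used in this file (not printed as a display):
on the bond `b = ⟨x, x + ηe_μ⟩` the middle member of (1.3) gives `(D^η_{A,μ}φ)(x) := (D^η_Aφ)(⟨x, x+ηe_μ⟩) = η⁻¹(U(A_μ(x))φ(x + ηe_μ) − φ(x))`,
the site/direction form in which (1.9)–(1.10) p. 573 write `D^η_{A,μ}`.  p. 577 [PDF 7], verbatim: *«R is a small operator in reasonable norms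
because |∂^ηh_j| ≦ O(M^{−1}), |Δ^ηh_j| ≦ O(M^{−2})»*; p. 573 [PDF 3], verbatim: *«|(D^η_{A,μ}G_k(Ω, A)f)(x)|, |(G_k(Ω, A)(x)| ≦
c₀ exp(−δ₀ dist(x, supp f))‖f‖_∞ (1.10)»* (sic: «(G_k(Ω, A)(x)|» for (G_k(Ω,A)f)(x), cf. [Balaban1982Higgs1] (2.25)).  [B1] p. 605 [PDF 3],
verbatim: *«U(A) = exp(qεeA), A ∈ R, where e is a coupling constant and q is an antisymmetric N × N matrix.»* and *«A covariant derivative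
for scalar fields is defined by the formula (D^ε_Aφ)(b) = ε^{−1}(U(A_b)φ(b₊) − φ(b₋)), b = ⟨b₋, b₊⟩. (1.7)»*; p. 610 (2.25) (quoted in
`B1Ineq225DecayBackgroundTorus`).

WHAT THIS FILE PROVES (kernel-checked, zero `sorry`, theorems only; axioms standard).
* §1 `covDeriv_hsmul` — LEIBNIZ: `D^ε_A(hF)(b) = h(b₋)·D^ε_AF(b) + (∂^εh)(b)·U(A_b)F(b₊)`; `covDeriv_congr_bond` (`D^ε_A F(b)` depends on
  `A` through `A_b` only); `|U(A_b)v| = |v|` is r02's `B2Restr216Lattice.norm_U_apply`.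
* §2 **THE BOND DICTIONARY** `smul_ofLp_covDeriv_toT`: for `z, z + e_i ∈ □` and `κσ = εe`,
  `(L^Kε)·D^ε_{Ã_j}u(⟨toT z, i⟩) = (D^η_{boxField,i}·pull u)(z)` (the lineage's `derivA` of the pulled-back field).
* §3 **«|∂^ηh_j| ≤ O(M⁻¹)» ON THE TORUS**: `abs_hTor_shift_sub_le` — `|h_j(x + εe_μ) − h_j(x)| ≤ (d(D₁+D₂)/K₀)·L^{−K}` for every site
  (`hsize_hBox.grad_le` along the chart; both values vanish off the core).
* §4 **THE PER-CUBE INPUT OF THE DERIVATIVE MEMBER** `norm_covDeriv_hsmul_le`: if `‖D^ε_{Ã_j}u(b)‖ ≤ γ_D` on the bonds of `□_j` and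
  `‖u‖_∞ ≤ γ₀`, then `‖D^ε_A(h_ju)‖_∞ ≤ γ_D + (d(D₁+D₂)/K₀)(L^Kε)⁻¹γ₀` for EVERY `A` (on `supp h_j` and its neighbours `A = Ã_j`).
HONEST SCOPE: dictionary/assembly lemmas only; the bound `γ_D` for `u = G_j(h_jψ)` (Lemma 2.2 (2.17) derivative member at `Ã_j`) is supplied
by the companion file from the lineage's `B4Lemma22CrossSup.lemma22_17_sup_box`.  Unit `lit-balaban-p35` gen 9
(literature-prover-lit-balaban-p35-g9-0).
-/

open scoped BigOperators Matrix

noncomputable section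

namespace Literature.MathematicalPhysics.QuantumFieldTheory.Balaban1983to89.B1TorusCubeDeriv

open Literature.MathematicalPhysics.QuantumFieldTheory.Balaban1983to89.HiggsLattice
open Literature.MathematicalPhysics.QuantumFieldTheory.Balaban1983to89.B1TorusCubeCover
open Literature.MathematicalPhysics.QuantumFieldTheory.Balaban1983to89.B1TorusCubeLocality26
open Literature.MathematicalPhysics.QuantumFieldTheory.Balaban1983to89.B1TorusCubeChart
open Literature.MathematicalPhysics.QuantumFieldTheory.Balaban1983to89.B1TorusCubeBoxOp (flowC boxField boxField_fwd ofLp_U hTor_toT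
  fld_pull_ofLp two_le_half)
open Literature.MathematicalPhysics.QuantumFieldTheory.Balaban1983to89.B4GaugeCovariance (fld fieldLink)
open Literature.MathematicalPhysics.QuantumFieldTheory.Balaban1983to89.B4Lower18Regular (e1)
open Literature.MathematicalPhysics.QuantumFieldTheory.Balaban1983to89.B4Lemma22ReduceZero (Box derivA)
open Literature.MathematicalPhysics.QuantumFieldTheory.Balaban1983to89.B4Lemma22ReduceDeriv (add_e1_mem_nbrs)
open Literature.MathematicalPhysics.QuantumFieldTheory.Balaban1983to89.B4PartitionUnity22 (hprof D1 D2 D1_nonneg D2_nonneg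
  contDiff_hprof hasCompactSupport_hprof)
open Literature.MathematicalPhysics.QuantumFieldTheory.Balaban1983to89.B4Eq220PartitionSizes (hBox hsize_hBox)
open Literature.MathematicalPhysics.QuantumFieldTheory.Balaban1983to89.B4Eq220CommutatorZeroBox (mem_boxNbrs_iff)
open Literature.MathematicalPhysics.QuantumFieldTheory.Balaban1983to89.B2Restr216Lattice (norm_U_apply)

variable {P : HiggsLattice.Params} {N : ℕ}

/-! ## §1 Leibniz rule and bond-locality of `D^ε_A` -/

section Leibniz

variable {k : ℕ}

/-- **LEIBNIZ FOR `D^ε_A`** ([B4] (2.3)–(2.4) in first-order form): `D^ε_A(hF)(b) = h(b₋)·(D^ε_AF)(b) + (∂^εh)(b)·U(A_b)F(b₊)`.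
[cite: Balaban1983RegularityDecay, (2.3)–(2.4) p.575; (1.3) p.572] [cite: Balaban1982Higgs1, (1.7) p.605] -/
theorem covDeriv_hsmul (C : ChargeData N) (A : HiggsLattice.VecField P k) (h : HiggsLattice.Site P k → ℝ) (F : HiggsLattice.ScalarField P k N) (b : HiggsLattice.PBond P k) :
    covDeriv C A (h • F) b = h b.src • covDeriv C A F b + sderiv h b • C.U (P.mesh k) (A b) (F b.tgt) := by
  unfold covDeriv sderiv
  rw [Pi.smul_apply', Pi.smul_apply', ContinuousLinearMap.map_smul, smul_eq_mul]
  module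

/-- `D^ε_AF(b)` depends on `A` only through `A_b`. [cite: Balaban1982Higgs1, (1.7) p.605] -/
theorem covDeriv_congr_bond (C : ChargeData N) {A A' : HiggsLattice.VecField P k} (F : HiggsLattice.ScalarField P k N) {b : HiggsLattice.PBond P k} (h : A b = A' b) :
    covDeriv C A F b = covDeriv C A' F b := by
  unfold covDeriv; rw [h]

/-- `|∂^εh(b)| = ε⁻¹|h(b₊) − h(b₋)|`. [cite: Balaban1982Higgs1, (1.4) p.604] -/
theorem abs_sderiv (h : HiggsLattice.Site P k → ℝ) (b : HiggsLattice.PBond P k) : |sderiv h b| = (P.mesh k)⁻¹ * |h b.tgt - h b.src| := by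
  unfold sderiv
  rw [smul_eq_mul, abs_mul, abs_of_pos (inv_pos.2 (P.mesh_pos k))]

end Leibniz

/-! ## §2 The bond dictionary: `(L^Kε)·D^ε_{Ã_j}u(⟨toT z, i⟩) = (derivA·pull u)(z)` -/

section Dictionary

variable {K K₀ : ℕ}

/-- `(L^Kε)·ε⁻¹ = L^K` (the lineage's `n = (L−1+1)^K`). [cite: Balaban1982Higgs1, (1.19) p.607] -/
theorem mesh_mul_inv_mesh_zero (P : HiggsLattice.Params) (K : ℕ) :
    P.mesh K * (P.mesh 0)⁻¹ = (((P.L - 1 + 1) ^ K : ℕ) : ℝ) := by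
  rw [predL_succ]
  unfold HiggsLattice.Params.mesh
  have hε := P.hε
  push_cast
  field_simp

/-- **THE BOND DICTIONARY FOR `D^ε`**: along the cube chart the model's covariant derivative at the cube configuration `Ã_j` is, up to
the factor `L^Kε`, the lineage's box derivative `D^η_{Ã}` (`derivA` with the flow `e^{tq}`, coupling `κ`, field `boxField`, `κσ = εe`) of
the pulled-back field: `(L^Kε)·(D^ε_{Ã_j}u)(⟨toT z, e_i⟩) = (derivA_i·pull u)(z)` for `z, z + e_i ∈ □`.
[cite: Balaban1983RegularityDecay, (1.3) p.572] [cite: Balaban1982Higgs1, (1.7) p.605] -/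
theorem smul_ofLp_covDeriv_toT (C : ChargeData N) (hK : K ≤ P.K) (hK₀ : K₀ ∣ P.M) (hK₀' : 1 ≤ K₀) (j : Lab P K K₀) {κ σ : ℝ}
    (hκσ : κ * σ = P.mesh 0 * C.e) (A : HiggsLattice.VecField P 0) (u : HiggsLattice.ScalarField P 0 N)
    (z : ↥(Box (dd P) (P.L - 1) K (M2 P K₀))) (i : Fin (dd P + 1)) (hz : z.1 + e1 i ∈ Box (dd P) (P.L - 1) K (M2 P K₀)) :
    P.mesh K • WithLp.ofLp (covDeriv C (cubeVec K K₀ j A) u ⟨toT K K₀ j z.1, castD P i⟩)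
      = fld (derivA (dd P) (flowC C) κ (P.L - 1) K (M2 P K₀) (boxField K K₀ j σ A) i *ᵥ pull K K₀ j u) z := by
  -- the box side
  rw [B4Lemma21Region.fld_covDeriv_mulVec_of_mem ((P.L - 1 + 1) ^ K) (fieldLink (flowC C) κ (boxField K K₀ j σ A))
    (pull K K₀ j u) hz]
  have hW : fieldLink (flowC C) κ (boxField K K₀ j σ A) z ⟨z.1 + e1 i, hz⟩
      = (flowC C).U (P.mesh 0 * C.e * cubeVec K K₀ j A ⟨toT K K₀ j z.1, castD P i⟩) := by
    unfold fieldLink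
    rw [boxField_fwd hK hK₀ hK₀' j C hκσ A (u := z) (v := ⟨z.1 + e1 i, hz⟩) rfl]
  rw [hW, fld_pull_ofLp, fld_pull_ofLp]
  -- the torus side
  have hL : covDeriv C (cubeVec K K₀ j A) u ⟨toT K K₀ j z.1, castD P i⟩
      = (P.mesh 0)⁻¹ • (C.U (P.mesh 0) (cubeVec K K₀ j A ⟨toT K K₀ j z.1, castD P i⟩) (u ((toT K K₀ j z.1).shift (castD P i)))
          - u (toT K K₀ j z.1)) := rfl
  rw [hL, WithLp.ofLp_smul, smul_smul, WithLp.ofLp_sub, ofLp_U, ← toT_add_e1, mesh_mul_inv_mesh_zero]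

end Dictionary

/-! ## §3 «|∂^ηh_j| ≤ O(M⁻¹)» for the torus bumps -/

section Bumps

variable {K K₀ : ℕ}

/-- **«|∂^ηh_j| ≤ O(M⁻¹)» ON THE TORUS**: `|h_j(x + εe_μ) − h_j(x)| ≤ ((d(D₁+D₂))/K₀)·L^{−K}` for every site `x` and direction `μ`
(`K₀ ≥ 8`, `K ≤ K_P`, `K₀ ∣ M`, `3M ≤ |T_ε|_μ`): on the core the two values are the lineage's `hBox` at lattice neighbours of the box
(`hsize_hBox.grad_le`), off the core both vanish. [cite: Balaban1983RegularityDecay, §2 p.577 «|∂^ηh_j| ≤ O(M⁻¹)»] -/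
theorem abs_hTor_shift_sub_le (hK : K ≤ P.K) (hK₀ : K₀ ∣ P.M) (hK₀8 : 8 ≤ K₀) (hN3 : ∀ μ, 3 * half P K K₀ ≤ P.sitesPerDir 0 μ)
    (j : Lab P K K₀) (x : HiggsLattice.Site P 0) (μ : Fin P.d) :
    |hTor K K₀ j (x.shift μ) - hTor K K₀ j x|
      ≤ ((dd P : ℝ) + 1) * (D1 hprof + D2 hprof) / K₀ / (((P.L - 1 + 1) ^ K : ℕ) : ℝ) := by
  have hK₀' : 1 ≤ K₀ := le_trans (by norm_num) hK₀8
  have hn : 1 ≤ (P.L - 1 + 1) ^ K := Nat.one_le_pow _ _ (Nat.succ_pos _)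
  have hnr : (0 : ℝ) < (((P.L - 1 + 1) ^ K : ℕ) : ℝ) := by exact_mod_cast hn
  have hD1 := D1_nonneg contDiff_hprof hasCompactSupport_hprof
  have hD2 := D2_nonneg contDiff_hprof hasCompactSupport_hprof
  have hK₀r : (0 : ℝ) < K₀ := by exact_mod_cast hK₀'
  by_cases hne : hTor K K₀ j x ≠ 0 ∨ hTor K K₀ j (x.shift μ) ≠ 0
  · -- both sites in `□_j`: chart points `z`, `z + e_i`
    have hx : Near K K₀ (rS P K K₀) j x :=
      hne.elim (near_rS_of_hTor_ne_zero hK hK₀ hK₀8) (near_rS_of_hTor_shift_ne_zero hK hK₀ hK₀8)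
    obtain ⟨hxc, hsc, -⟩ := mem_cube_of_near hK₀8 hx μ
    have hh2 : 2 ≤ half P K K₀ := two_le_half hK₀8
    have hnK3 : 3 ≤ (P.L - 1 + 1) ^ K * K₀ := by nlinarith
    have hKM : ∀ ν, K₀ ∣ M2 P K₀ ν := fun ν => ⟨2, by unfold M2; ring⟩
    set z : Fin (dd P + 1) → ℤ := fromT K K₀ j x with hz_def
    have hz : z ∈ Box (dd P) (P.L - 1) K (M2 P K₀) := (mem_cube_iff hK hK₀ hK₀' j x).1 hxc
    have hxz : toT K K₀ j z = x := toT_fromT j x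
    set i : Fin (dd P + 1) := (castD P).symm μ with hi_def
    have hμ : castD P i = μ := Equiv.apply_symm_apply _ _
    have hz' : z + e1 i ∈ Box (dd P) (P.L - 1) K (M2 P K₀) :=
      (add_e1_mem_box_iff hK hK₀ hK₀' hN3 hh2 j hz i).2 (by rw [hxz, hμ]; exact hsc)
    have h1 := hTor_toT hK hK₀ hK₀' j ⟨z, hz⟩
    have h2 := hTor_toT hK hK₀ hK₀' j ⟨z + e1 i, hz'⟩
    simp only at h1 h2
    rw [hxz] at h1
    rw [toT_add_e1, hxz, hμ] at h2
    have hHS := hsize_hBox (d := dd P) hn hK₀' hnK3 hKM (fun _ : Fin (dd P + 1) => (1 : ℤ))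
    have hg := hHS.grad_le ⟨z, hz⟩ ⟨z + e1 i, hz'⟩ (mem_boxNbrs_iff.2 (add_e1_mem_nbrs z i))
    rw [h1, h2]
    rw [le_div_iff₀ hnr, mul_comm]
    exact hg
  · push Not at hne
    rw [hne.1, hne.2, sub_zero, abs_zero]
    positivity

/-- Hence `|∂^εh_j(b)| ≤ (d(D₁+D₂)/K₀)·(L^Kε)⁻¹`. [cite: Balaban1983RegularityDecay, §2 p.577 «|∂^ηh_j| ≤ O(M⁻¹)»] -/
theorem abs_sderiv_hTor_le (hK : K ≤ P.K) (hK₀ : K₀ ∣ P.M) (hK₀8 : 8 ≤ K₀) (hN3 : ∀ μ, 3 * half P K K₀ ≤ P.sitesPerDir 0 μ)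
    (j : Lab P K K₀) (b : HiggsLattice.PBond P 0) :
    |sderiv (hTor K K₀ j) b| ≤ ((dd P : ℝ) + 1) * (D1 hprof + D2 hprof) / K₀ * (P.mesh K)⁻¹ := by
  rw [abs_sderiv]
  have h := abs_hTor_shift_sub_le hK hK₀ hK₀8 hN3 j b.src b.dir
  have hm0 : 0 < P.mesh 0 := P.mesh_pos 0
  have hmK : 0 < P.mesh K := P.mesh_pos K
  calc (P.mesh 0)⁻¹ * |hTor K K₀ j b.tgt - hTor K K₀ j b.src|
      ≤ (P.mesh 0)⁻¹ * (((dd P : ℝ) + 1) * (D1 hprof + D2 hprof) / K₀ / (((P.L - 1 + 1) ^ K : ℕ) : ℝ)) :=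
        mul_le_mul_of_nonneg_left h (inv_pos.2 hm0).le
    _ = ((dd P : ℝ) + 1) * (D1 hprof + D2 hprof) / K₀ * (P.mesh K)⁻¹ := by
        rw [← mesh_mul_inv_mesh_zero]
        field_simp

end Bumps

/-! ## §4 The per-cube input of the derivative member: `‖D^ε_A(h_ju)‖_∞` -/

section Input

variable {K K₀ : ℕ}

/-- **THE PER-CUBE INPUT OF THE DERIVATIVE MEMBER OF THEOREM (1.10) ON THE TORUS.**  Let `K₀ ≥ 8`, `K ≤ K_P`, `K₀ ∣ M`, `3M ≤ |T_ε|_μ`,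
ANY `A`, and a field `u` with `‖D^ε_{Ã_j}u(b)‖ ≤ γ_D` on every bond of `□_j` and `‖u‖_∞ ≤ γ₀` (for `u = G_j(h_jψ)`: Lemma 2.2 (2.17),
derivative and value members).  Then `‖D^ε_A(h_ju)‖_∞ ≤ γ_D + (d(D₁+D₂)/K₀)(L^Kε)⁻¹γ₀` — Leibniz, `A = Ã_j` on the bonds at `supp h_j`
(`θ_j = 1` there), `|U(A_b)| = 1` and «|∂^ηh_j| ≤ O(M⁻¹)».
[cite: Balaban1983RegularityDecay, Theorem (1.10) p.573; (2.13) p.577; Lemma 2.2 (2.17) p.578] [cite: Balaban1982Higgs1, Prop. 2.1 (2.25) p.610] -/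
theorem norm_covDeriv_hsmul_le (C : ChargeData N) (hK : K ≤ P.K) (hK₀ : K₀ ∣ P.M) (hK₀8 : 8 ≤ K₀)
    (hN3 : ∀ μ, 3 * half P K K₀ ≤ P.sitesPerDir 0 μ) (j : Lab P K K₀) (A : HiggsLattice.VecField P 0) (u : HiggsLattice.ScalarField P 0 N)
    {γD γ0 : ℝ} (hγD : 0 ≤ γD) (hγ0 : 0 ≤ γ0)
    (hDu : ∀ (x : HiggsLattice.Site P 0) (μ : Fin P.d), x ∈ cube K K₀ j → x.shift μ ∈ cube K K₀ j →
      ‖covDeriv C (cubeVec K K₀ j A) u ⟨x, μ⟩‖ ≤ γD)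
    (hu : ∀ x, ‖u x‖ ≤ γ0) :
    ‖(fun b => covDeriv C A (hTor K K₀ j • u) b : HiggsLattice.PBond P 0 → EuclideanSpace ℝ (Fin N))‖
      ≤ γD + ((dd P : ℝ) + 1) * (D1 hprof + D2 hprof) / K₀ * (P.mesh K)⁻¹ * γ0 := by
  have hK₀' : 1 ≤ K₀ := le_trans (by norm_num) hK₀8
  have hD1 := D1_nonneg contDiff_hprof hasCompactSupport_hprof
  have hD2 := D2_nonneg contDiff_hprof hasCompactSupport_hprof
  have hmK : 0 < P.mesh K := P.mesh_pos K
  have hrhs : 0 ≤ γD + ((dd P : ℝ) + 1) * (D1 hprof + D2 hprof) / K₀ * (P.mesh K)⁻¹ * γ0 := by positivity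
  refine (pi_norm_le_iff_of_nonneg hrhs).2 fun b => ?_
  obtain ⟨x, μ⟩ := b
  rw [covDeriv_hsmul]
  by_cases hne : hTor K K₀ j x ≠ 0 ∨ hTor K K₀ j (x.shift μ) ≠ 0
  · have hx : Near K K₀ (rS P K K₀) j x :=
      hne.elim (near_rS_of_hTor_ne_zero hK hK₀ hK₀8) (near_rS_of_hTor_shift_ne_zero hK hK₀ hK₀8)
    obtain ⟨hxc, hsc, -⟩ := mem_cube_of_near hK₀8 hx μ
    have hθ : thetaTor K K₀ j x = 1 := thetaTor_eq_one_of_near_rS hK hK₀ hK₀8 hx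
    have hAb : A ⟨x, μ⟩ = cubeVec K K₀ j A ⟨x, μ⟩ := (cubeVec_apply_of_thetaTor_eq_one (b := ⟨x, μ⟩) hθ).symm
    rw [covDeriv_congr_bond C u hAb]
    refine (norm_add_le _ _).trans (add_le_add ?_ ?_)
    · rw [norm_smul, Real.norm_eq_abs]
      calc |hTor K K₀ j x| * ‖covDeriv C (cubeVec K K₀ j A) u ⟨x, μ⟩‖ ≤ 1 * γD :=
            mul_le_mul (abs_hTor_le_one hK hK₀ hK₀' j x) (hDu x μ hxc hsc) (norm_nonneg _) zero_le_one
        _ = γD := one_mul _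
    · rw [norm_smul, Real.norm_eq_abs, norm_U_apply]
      exact mul_le_mul (abs_sderiv_hTor_le hK hK₀ hK₀8 hN3 j ⟨x, μ⟩) (hu _) (norm_nonneg _) (by positivity)
  · push Not at hne
    have h0 : sderiv (hTor K K₀ j) ⟨x, μ⟩ = 0 := by
      unfold sderiv
      rw [show (HiggsLattice.PBond.tgt ⟨x, μ⟩ : HiggsLattice.Site P 0) = x.shift μ from rfl, hne.2]
      simp [hne.1]
    rw [hne.1, h0, zero_smul, zero_smul, add_zero, norm_zero]
    exact hrhs

end Input

end Literature.MathematicalPhysics.QuantumFieldTheory.Balaban1983to89.B1TorusCubeDeriv
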